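import Summits.RiemannHypothesis.RiemannHypothesis.Theorems.WeilFormatCCinfA1Floors
import HarnessLib

/-!
# C∞ rung at `a = 1`: rung-side LINKS (window casts, the reciprocal-weight link `hVW`)

Route context: Fourier–Galerkin / Schur-complement certificates of Weil positivity on a window ("format C", design C∞; pipeline door
`WeilFormatC.weilPositivityOn_of_cinf_pipeline`; cell memo `run/shared/lean/pub/rh-explicit/rh-explicit-weil-10/KERNEL-LEVER.md` §24;
supporting stmt-RiemannHypothesis-0098; seat rh-explicit-weil-10).  One-liners every a = 1 rung module would otherwise re-derive:

* `A1.a_eq_one` (so `a ≤ 1` for K3 is `a_eq_one.le`), `A1.a_eq_ratCast` (`A1.a = ((1 : ℚ) : ℝ)`) — the kit's window term versus the literal window and the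
  `(a : ℚ)`-casts in which the C∞ box lemmas (`CinfCoeff.*`, `CinfPrim*`, `CinfImgIn.*`) are stated;
* `A1.primeData_rat`, `A1.consts_valid_rat`, `A1.fdA_valid_rat` — the kernel-rung facts transported to the `ℚ`-cast window;
* `A1.Cinf.one_div_wtabE` / `one_div_wtabO` — `1 / wtab (B + t) = VW_t / 2^64` for the door's `wtabe := wvF A1.Cinf.vwE 64 (47 + 1)`,
  `wtabo := wvF A1.Cinf.vwO 64 96`, written with the literal bases `48` / `96` that rh-explicit-weil-2's stage link `hVW`
  (`CinfGlueE.vN 48 wmid t = 1 / wmid (48 + t)`) prints.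

No analysis; standard axioms; no RH claim.
-/

set_option linter.dupNamespace false
set_option autoImplicit false

noncomputable section

namespace Summit.RiemannHypothesis.RiemannHypothesis.Theorems.WeilFormatCData.A1
open Literature.NumberTheory.LFunctions Literature.NumberTheory.LFunctions.Yoshida1992 Encl

/-- The kit's window term is `1`. -/
theorem a_eq_one : a = 1 := by unfold a; norm_num

/-- The kit's window term is the cast of the rational `1`. -/
theorem a_eq_ratCast : a = ((1 : ℚ) : ℝ) := by rw [a_eq_one]; norm_num

/-- `0 < (1 : ℚ)` (the `ha` of the `ℚ`-stated box lemmas). -/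
theorem ratOne_pos : (0 : ℚ) < 1 := one_pos

/-- The prime data of the window at the `ℚ`-cast window. -/
theorem primeData_rat : PrimeData (((1 : ℚ) : ℝ)) ks := by
  rw [← a_eq_ratCast]; exact primeData

/-- The constants record is valid at the `ℚ`-cast window. -/
theorem consts_valid_rat : ConstsValid (2 ^ 256) (((1 : ℚ) : ℝ)) ks C := by
  rw [← a_eq_ratCast]; exact consts_valid

/-- The front-door constants with `A = 2027/1000` at the `ℚ`-cast window. -/
theorem fdA_valid_rat : FDValidA (2 ^ 256) (((1 : ℚ) : ℝ)) (((2027 : ℤ) : ℝ) / (1000 : ℕ)) FA := by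
  rw [← a_eq_ratCast]; exact fdA_valid

namespace Cinf

/-- **The even reciprocal-weight link**: `1 / wtabe (48 + t) = vwE_t / 2^64` for `wtabe := wvF vwE 64 (47 + 1)`. -/
theorem one_div_wtabE (t : ℕ) : 1 / wvF vwE 64 (47 + 1) (48 + t) = ((vwE.getD t 0 : ℕ) : ℝ) / 2 ^ 64 := by
  rw [show (48 + t : ℕ) = 47 + 1 + t by omega]
  exact one_div_wvF vwE 64 (47 + 1) t

/-- **The odd reciprocal-weight link**: `1 / wtabo (96 + t) = vwO_t / 2^64` for `wtabo := wvF vwO 64 96`. -/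
theorem one_div_wtabO (t : ℕ) : 1 / wvF vwO 64 96 (96 + t) = ((vwO.getD t 0 : ℕ) : ℝ) / 2 ^ 64 :=
  one_div_wvF vwO 64 96 t

/-- The far values as reals: `d₁e = 2^64 / e1E`, i.e. `1 / d₁e = e1E / 2^64`. -/
theorem one_div_d1E : 1 / ((2 : ℝ) ^ 64 / e1E) = (e1E : ℝ) / 2 ^ 64 := by
  rw [one_div_div]

/-- `1 / d₁o = e1O / 2^64`. -/
theorem one_div_d1O : 1 / ((2 : ℝ) ^ 64 / e1O) = (e1O : ℝ) / 2 ^ 64 := by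
  rw [one_div_div]

end Cinf

end Summit.RiemannHypothesis.RiemannHypothesis.Theorems.WeilFormatCData.A1

end
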